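import Mathlib
import HarnessLib
import Summits.Ventures.LatticeQCDFlow.Exactness.VandermondeIdentityDegenerate
import Summits.Ventures.LatticeQCDFlow.Exactness.SpectralTorusBasics
import Summits.Ventures.LatticeQCDFlow.Exactness.SUNTorusAlcoveJacobian

/-!
# The booked density of the `SU(N)` spectral kernel, every `N`: the torus density and Boyda's identity are DISCHARGED from "`J` is a symmetric function of the spectrum with the booked value on the alcove chart"

HONEST FRAMING: exact (Metropolis-corrected) sampling algorithms for lattice gauge theory;
figures of merit are autocorrelation/cost numbers at stated couplings and volumes; no
continuum-physics claim.

Venture `LatticeQCDFlow` (cell pub-lqcd), topic `Exactness`; FANOUT row 10 (`eng-equiv`, engine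
`latflow.equiv` `spectral.spectral_kernel`, general `N`: `ldj = ld_cell + log_haar(x') − log_haar(x)`,
`log_haar(x) = log |Δ(e^{ix})|²`; Boyda et al., PRD 103 (2021) 074504, App. B Algorithm 2 step 10).  NEW
WORK of the cell: the every-`N` version of `SU3TorusBookedDensity.lean`, over this row's
`SUNTorusAlcoveJacobian.lean` / `SUNTorusChamberDecomposition.lean` / `SUNAlcoveFundamentalDomain.lean` and
`SpectralTorusBasics.lean`.  Nothing is cited as a fact; no number; no definition.

## What is typed (`x(θ) = Fin.snoc θ (−Σθ)`, `A = {x(θ) strictly increasing, x(θ)(last) < x(θ)(0) + 2π}`,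
`D(d) = (∏_i ∏_{j≠i} ‖d_i − d_j‖)/(n+1)!`)

* **`exists_permDiag_angleChart_of_regular_sun`** (every REGULAR `t ∈ SΔ(n+1)` is `P σ (E θ)`, `θ ∈ A`;
  over `angleChart_sun_arg` / `angleChart_sun_regular` of `SUNTorusAlcoveJacobian.lean`);
* **`exists_torusDensity_sun_booked`** — for `f` permutation-equivariant and given on the alcove by `G`
  (`G(A) ⊆ A`) with torus map `fT`, and `J` any symmetric measurable function `JD` of the spectrum with
  `JD(e^{ix(θ)}) D(e^{ix(θ)}) = JA(θ) D(e^{ix(Gθ)})` on `A`: a measurable Weyl-invariant torus density `Jf`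
  with `Jf ∘ E = JA` on `A` EXISTS and Boyda's identity holds for ALL `(g, t)`.

NOT here: the kernel / layer corollaries (`SUNSpectralCouplingLayerBooked.lean`); the cell charts; any number.
-/

noncomputable section

namespace Summit.Ventures.LatticeQCDFlow.Exactness

open MeasureTheory Matrix Set Real
open Literature.LinearAlgebra.Matrix
open Literature.MathematicalPhysics.QuantumFieldTheory (haarProbability)
open scoped ENNReal

variable {n : ℕ}

section Chart

variable {E : (Fin n → ℝ) → specialDiagonalTorus (Fin (n + 1))}
  (hE : ∀ θ (i : Fin (n + 1)), (((E θ : specialDiagonalTorus (Fin (n + 1))) : Matrix.specialUnitaryGroup (Fin (n + 1)) ℂ) :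
    Matrix (Fin (n + 1)) (Fin (n + 1)) ℂ) i i = (Circle.exp ((Fin.snoc θ (-∑ k, θ k) : Fin (n + 1) → ℝ) i) : ℂ))

include hE

variable {P : Equiv.Perm (Fin (n + 1)) → specialDiagonalTorus (Fin (n + 1)) → specialDiagonalTorus (Fin (n + 1))}
  (hP : ∀ σ t i, (((P σ t : specialDiagonalTorus (Fin (n + 1))) : Matrix.specialUnitaryGroup (Fin (n + 1)) ℂ) :
    Matrix (Fin (n + 1)) (Fin (n + 1)) ℂ) i i =
      ((t : Matrix.specialUnitaryGroup (Fin (n + 1)) ℂ) : Matrix (Fin (n + 1)) (Fin (n + 1)) ℂ) (σ i) (σ i))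

include hP

/-- **Every regular point of `SΔ(n+1)` is a Weyl image of an alcove chart point**: if the diagonal
entries of `t` are pairwise distinct then `t = P σ (E θ)` with `θ` in the alcove — Algorithm 1 on the
torus, every `N`. -/
theorem exists_permDiag_angleChart_of_regular_sun {t : specialDiagonalTorus (Fin (n + 1))}
    (hreg : ∀ i j, i ≠ j → ((t : Matrix.specialUnitaryGroup (Fin (n + 1)) ℂ) : Matrix (Fin (n + 1)) (Fin (n + 1)) ℂ) i i ≠
      ((t : Matrix.specialUnitaryGroup (Fin (n + 1)) ℂ) : Matrix (Fin (n + 1)) (Fin (n + 1)) ℂ) j j) :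
    ∃ (σ : Equiv.Perm (Fin (n + 1))) (θ : Fin n → ℝ),
      (StrictMono (Fin.snoc θ (-∑ k, θ k) : Fin (n + 1) → ℝ) ∧
        (Fin.snoc θ (-∑ k, θ k) : Fin (n + 1) → ℝ) (Fin.last n) < (Fin.snoc θ (-∑ k, θ k) : Fin (n + 1) → ℝ) 0 + 2 * π) ∧
      t = P σ (E θ) := by
  set θ₀ : Fin n → ℝ := fun k => Complex.arg (((t : Matrix.specialUnitaryGroup (Fin (n + 1)) ℂ) :
    Matrix (Fin (n + 1)) (Fin (n + 1)) ℂ) k.castSucc k.castSucc) with hθ₀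
  have hEθ₀ : ∀ i : Fin (n + 1), (Circle.exp ((Fin.snoc θ₀ (-∑ k, θ₀ k) : Fin (n + 1) → ℝ) i) : ℂ) =
      ((t : Matrix.specialUnitaryGroup (Fin (n + 1)) ℂ) : Matrix (Fin (n + 1)) (Fin (n + 1)) ℂ) i i :=
    angleChart_sun_arg t
  have hEt : E θ₀ = t := specialDiagonalTorus_ext fun i => by rw [hE, hEθ₀]
  have hoff : ∀ i j : Fin (n + 1), i ≠ j → ∀ k : ℤ,
      (Fin.snoc θ₀ (-∑ k, θ₀ k) : Fin (n + 1) → ℝ) i - (Fin.snoc θ₀ (-∑ k, θ₀ k) : Fin (n + 1) → ℝ) j ≠ k * (2 * π) := by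
    intro i j hij k hk
    apply hreg i j hij
    rw [← hEθ₀ i, ← hEθ₀ j]
    congr 1
    exact Circle.exp_eq_exp.mpr ⟨k, by linarith⟩
  obtain ⟨m, τ, hmem⟩ := exists_intMul_add_mem_chamber_sun
    (C := fun τ : Equiv.Perm (Fin (n + 1)) => {θ : Fin n → ℝ |
      StrictMono ((Fin.snoc θ (-∑ k, θ k) : Fin (n + 1) → ℝ) ∘ τ) ∧
        (Fin.snoc θ (-∑ k, θ k) : Fin (n + 1) → ℝ) (τ (Fin.last n)) <
          (Fin.snoc θ (-∑ k, θ k) : Fin (n + 1) → ℝ) (τ 0) + 2 * π}) (fun _ _ => Iff.rfl) hoff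
  set θ₁ : Fin n → ℝ := (fun k => (m k : ℝ) * (2 * π)) + θ₀ with hθ₁
  set θ : Fin n → ℝ := fun k : Fin n => (Fin.snoc θ₁ (-∑ k, θ₁ k) : Fin (n + 1) → ℝ) (τ k.castSucc) with hθ
  have hθA : θ ∈ {θ : Fin n → ℝ | StrictMono ((Fin.snoc θ (-∑ k, θ k) : Fin (n + 1) → ℝ) ∘ ⇑(1 : Equiv.Perm (Fin (n + 1)))) ∧
      (Fin.snoc θ (-∑ k, θ k) : Fin (n + 1) → ℝ) ((1 : Equiv.Perm (Fin (n + 1))) (Fin.last n)) <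
        (Fin.snoc θ (-∑ k, θ k) : Fin (n + 1) → ℝ) ((1 : Equiv.Perm (Fin (n + 1))) 0) + 2 * π} := by
    have h := preimage_chamber_perm_sun
      (C := fun τ : Equiv.Perm (Fin (n + 1)) => {θ : Fin n → ℝ |
        StrictMono ((Fin.snoc θ (-∑ k, θ k) : Fin (n + 1) → ℝ) ∘ τ) ∧
          (Fin.snoc θ (-∑ k, θ k) : Fin (n + 1) → ℝ) (τ (Fin.last n)) <
            (Fin.snoc θ (-∑ k, θ k) : Fin (n + 1) → ℝ) (τ 0) + 2 * π}) (fun _ _ => Iff.rfl) τ 1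
    rw [mul_one] at h
    have hθ₁C : θ₁ ∈ (fun θ' : Fin n → ℝ => fun k : Fin n =>
        (Fin.snoc θ' (-∑ k, θ' k) : Fin (n + 1) → ℝ) (τ k.castSucc)) ⁻¹' {θ : Fin n → ℝ |
        StrictMono ((Fin.snoc θ (-∑ k, θ k) : Fin (n + 1) → ℝ) ∘ ⇑(1 : Equiv.Perm (Fin (n + 1)))) ∧
          (Fin.snoc θ (-∑ k, θ k) : Fin (n + 1) → ℝ) ((1 : Equiv.Perm (Fin (n + 1))) (Fin.last n)) <
            (Fin.snoc θ (-∑ k, θ k) : Fin (n + 1) → ℝ) ((1 : Equiv.Perm (Fin (n + 1))) 0) + 2 * π} := by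
      rw [h]
      exact hmem
    exact hθ₁C
  rw [alcove_sun_eq_chamber_one] at hθA
  refine ⟨τ⁻¹, θ, hθA, ?_⟩
  have hEθ : E θ = P τ t := by
    rw [← hEt, ← angleChart_sun_intMul_add hE m θ₀, permDiag_angleChart_sun hE hP τ]
  rw [hEθ, permDiag_inv_permDiag hP]

end Chart

/-! ## The booked density, every `N` -/

section Booked

variable {E : (Fin n → ℝ) → specialDiagonalTorus (Fin (n + 1))}
  (hE : ∀ θ (i : Fin (n + 1)), (((E θ : specialDiagonalTorus (Fin (n + 1))) : Matrix.specialUnitaryGroup (Fin (n + 1)) ℂ) :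
    Matrix (Fin (n + 1)) (Fin (n + 1)) ℂ) i i = (Circle.exp ((Fin.snoc θ (-∑ k, θ k) : Fin (n + 1) → ℝ) i) : ℂ))
  {P : Equiv.Perm (Fin (n + 1)) → specialDiagonalTorus (Fin (n + 1)) → specialDiagonalTorus (Fin (n + 1))}
  (hP : ∀ σ t i, (((P σ t : specialDiagonalTorus (Fin (n + 1))) : Matrix.specialUnitaryGroup (Fin (n + 1)) ℂ) :
    Matrix (Fin (n + 1)) (Fin (n + 1)) ℂ) i i =
      ((t : Matrix.specialUnitaryGroup (Fin (n + 1)) ℂ) : Matrix (Fin (n + 1)) (Fin (n + 1)) ℂ) (σ i) (σ i))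

include hE hP

/-- **The booked torus density of the `SU(n+1)` spectral kernel, every `N`.**  `f` measurable on the
unimodular torus, permutation-equivariant, given on the alcove `A` by `G` with `G(A) ⊆ A`
(`f(e^{ix(θ)}) = e^{ix(Gθ)}`), torus map `fT`; `J` a symmetric measurable function `JD` of the spectrum
(`J(V diag d V⋆) = JD d`) with the booked alcove value `JD(e^{ix(θ)}) D(e^{ix(θ)}) = JA(θ) D(e^{ix(Gθ)})`.
Then a measurable Weyl-invariant `Jf` with `Jf ∘ E = JA` on `A` exists and Boyda's identity
`J(g t g⁻¹) D(t) = Jf(t) D(fT t)` holds for all `g`, `t`. -/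
theorem exists_torusDensity_sun_booked
    {f : (Fin (n + 1) → ℂ) → (Fin (n + 1) → ℂ)} (hfm : Measurable f)
    (hfperm : ∀ (σ : Equiv.Perm (Fin (n + 1))) (d : Fin (n + 1) → ℂ), (∀ i, ‖d i‖ = 1) →
      f (fun i => d (σ i)) = fun i => f d (σ i))
    {G : (Fin n → ℝ) → (Fin n → ℝ)} {JA : (Fin n → ℝ) → ℝ≥0∞}
    (hGA : ∀ θ : Fin n → ℝ, StrictMono (Fin.snoc θ (-∑ k, θ k) : Fin (n + 1) → ℝ) →
      (Fin.snoc θ (-∑ k, θ k) : Fin (n + 1) → ℝ) (Fin.last n) < (Fin.snoc θ (-∑ k, θ k) : Fin (n + 1) → ℝ) 0 + 2 * π →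
        StrictMono (Fin.snoc (G θ) (-∑ k, (G θ) k) : Fin (n + 1) → ℝ) ∧
          (Fin.snoc (G θ) (-∑ k, (G θ) k) : Fin (n + 1) → ℝ) (Fin.last n) <
            (Fin.snoc (G θ) (-∑ k, (G θ) k) : Fin (n + 1) → ℝ) 0 + 2 * π)
    (hfG : ∀ θ : Fin n → ℝ, StrictMono (Fin.snoc θ (-∑ k, θ k) : Fin (n + 1) → ℝ) →
      (Fin.snoc θ (-∑ k, θ k) : Fin (n + 1) → ℝ) (Fin.last n) < (Fin.snoc θ (-∑ k, θ k) : Fin (n + 1) → ℝ) 0 + 2 * π →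
        f (fun i => (Circle.exp ((Fin.snoc θ (-∑ k, θ k) : Fin (n + 1) → ℝ) i) : ℂ)) =
          fun i => (Circle.exp ((Fin.snoc (G θ) (-∑ k, (G θ) k) : Fin (n + 1) → ℝ) i) : ℂ))
    {fT : specialDiagonalTorus (Fin (n + 1)) → specialDiagonalTorus (Fin (n + 1))}
    (hfT : ∀ t : specialDiagonalTorus (Fin (n + 1)),
      ((fT t : Matrix.specialUnitaryGroup (Fin (n + 1)) ℂ) : Matrix (Fin (n + 1)) (Fin (n + 1)) ℂ) =
        diagonal (f fun i => ((t : Matrix.specialUnitaryGroup (Fin (n + 1)) ℂ) : Matrix (Fin (n + 1)) (Fin (n + 1)) ℂ) i i))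
    {JD : (Fin (n + 1) → ℂ) → ℝ≥0∞} (hJDm : Measurable JD)
    (hJDperm : ∀ (σ : Equiv.Perm (Fin (n + 1))) (d : Fin (n + 1) → ℂ), JD (fun i => d (σ i)) = JD d)
    (hJchart : ∀ θ : Fin n → ℝ, StrictMono (Fin.snoc θ (-∑ k, θ k) : Fin (n + 1) → ℝ) →
      (Fin.snoc θ (-∑ k, θ k) : Fin (n + 1) → ℝ) (Fin.last n) < (Fin.snoc θ (-∑ k, θ k) : Fin (n + 1) → ℝ) 0 + 2 * π →
      JD (fun i => (Circle.exp ((Fin.snoc θ (-∑ k, θ k) : Fin (n + 1) → ℝ) i) : ℂ)) * ENNReal.ofReal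
          ((∏ i, ∏ k ∈ Finset.univ.erase i,
            ‖(Circle.exp ((Fin.snoc θ (-∑ k, θ k) : Fin (n + 1) → ℝ) i) : ℂ) -
              (Circle.exp ((Fin.snoc θ (-∑ k, θ k) : Fin (n + 1) → ℝ) k) : ℂ)‖) / (Fintype.card (Fin (n + 1))).factorial) =
        JA θ * ENNReal.ofReal
          ((∏ i, ∏ k ∈ Finset.univ.erase i,
            ‖(Circle.exp ((Fin.snoc (G θ) (-∑ k, (G θ) k) : Fin (n + 1) → ℝ) i) : ℂ) -
              (Circle.exp ((Fin.snoc (G θ) (-∑ k, (G θ) k) : Fin (n + 1) → ℝ) k) : ℂ)‖) /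
                (Fintype.card (Fin (n + 1))).factorial))
    {J : Matrix.specialUnitaryGroup (Fin (n + 1)) ℂ → ℝ≥0∞}
    (hJspec : ∀ (W : Matrix.specialUnitaryGroup (Fin (n + 1)) ℂ) (V : Matrix (Fin (n + 1)) (Fin (n + 1)) ℂ) (d : Fin (n + 1) → ℂ),
      V ∈ Matrix.unitaryGroup (Fin (n + 1)) ℂ → (W : Matrix (Fin (n + 1)) (Fin (n + 1)) ℂ) = V * diagonal d * star V →
        J W = JD d) :
    ∃ Jf : specialDiagonalTorus (Fin (n + 1)) → ℝ≥0∞, Measurable Jf ∧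
      (∀ θ : Fin n → ℝ, StrictMono (Fin.snoc θ (-∑ k, θ k) : Fin (n + 1) → ℝ) →
        (Fin.snoc θ (-∑ k, θ k) : Fin (n + 1) → ℝ) (Fin.last n) < (Fin.snoc θ (-∑ k, θ k) : Fin (n + 1) → ℝ) 0 + 2 * π →
          Jf (E θ) = JA θ) ∧
      (∀ σ t, Jf (P σ t) = Jf t) ∧
      ∀ (g : Matrix.specialUnitaryGroup (Fin (n + 1)) ℂ) (t : specialDiagonalTorus (Fin (n + 1))),
        J (g * (t : Matrix.specialUnitaryGroup (Fin (n + 1)) ℂ) * g⁻¹) * ENNReal.ofReal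
            ((∏ i, ∏ k ∈ Finset.univ.erase i,
              ‖((t : Matrix.specialUnitaryGroup (Fin (n + 1)) ℂ) : Matrix (Fin (n + 1)) (Fin (n + 1)) ℂ) i i -
                ((t : Matrix.specialUnitaryGroup (Fin (n + 1)) ℂ) : Matrix (Fin (n + 1)) (Fin (n + 1)) ℂ) k k‖) /
                  (Fintype.card (Fin (n + 1))).factorial) =
          Jf t * ENNReal.ofReal
            ((∏ i, ∏ k ∈ Finset.univ.erase i,
              ‖((fT t : Matrix.specialUnitaryGroup (Fin (n + 1)) ℂ) : Matrix (Fin (n + 1)) (Fin (n + 1)) ℂ) i i -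
                ((fT t : Matrix.specialUnitaryGroup (Fin (n + 1)) ℂ) : Matrix (Fin (n + 1)) (Fin (n + 1)) ℂ) k k‖) /
                  (Fintype.card (Fin (n + 1))).factorial) := by
  have hentries_cont : ∀ i : Fin (n + 1), Continuous fun t : specialDiagonalTorus (Fin (n + 1)) =>
      ((t : Matrix.specialUnitaryGroup (Fin (n + 1)) ℂ) : Matrix (Fin (n + 1)) (Fin (n + 1)) ℂ) i i := fun i =>
    ((continuous_apply i).comp ((continuous_apply i).comp (continuous_subtype_val.comp continuous_subtype_val)))
  have hent : Measurable fun t : specialDiagonalTorus (Fin (n + 1)) => fun i =>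
      ((t : Matrix.specialUnitaryGroup (Fin (n + 1)) ℂ) : Matrix (Fin (n + 1)) (Fin (n + 1)) ℂ) i i :=
    (continuous_pi hentries_cont).measurable
  have hDm : Measurable fun t : specialDiagonalTorus (Fin (n + 1)) => ENNReal.ofReal
      ((∏ i, ∏ k ∈ Finset.univ.erase i,
        ‖((t : Matrix.specialUnitaryGroup (Fin (n + 1)) ℂ) : Matrix (Fin (n + 1)) (Fin (n + 1)) ℂ) i i -
          ((t : Matrix.specialUnitaryGroup (Fin (n + 1)) ℂ) : Matrix (Fin (n + 1)) (Fin (n + 1)) ℂ) k k‖) /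
            (Fintype.card (Fin (n + 1))).factorial) :=
    measurable_vandermondeWeight_special
  have hfTm : Measurable fT := measurable_torusMap_of_measurable hfm hfT
  have hfTent : ∀ t i, ((fT t : Matrix.specialUnitaryGroup (Fin (n + 1)) ℂ) : Matrix (Fin (n + 1)) (Fin (n + 1)) ℂ) i i =
      f (fun k => ((t : Matrix.specialUnitaryGroup (Fin (n + 1)) ℂ) : Matrix (Fin (n + 1)) (Fin (n + 1)) ℂ) k k) i := by
    intro t i
    rw [hfT, diagonal_apply_eq]
  have hequiv : ∀ σ t, fT (P σ t) = P σ (fT t) := fun σ t => torusMap_permDiag (hP σ) (hfperm σ) hfT t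
  have hcomm : ∀ θ : Fin n → ℝ, StrictMono (Fin.snoc θ (-∑ k, θ k) : Fin (n + 1) → ℝ) →
      (Fin.snoc θ (-∑ k, θ k) : Fin (n + 1) → ℝ) (Fin.last n) < (Fin.snoc θ (-∑ k, θ k) : Fin (n + 1) → ℝ) 0 + 2 * π →
        fT (E θ) = E (G θ) := fun θ h0 h1 => torusMap_angleChart_sun hE hfT (hfG θ h0 h1)
  have hDne : ∀ θ : Fin n → ℝ, StrictMono (Fin.snoc θ (-∑ k, θ k) : Fin (n + 1) → ℝ) →
      (Fin.snoc θ (-∑ k, θ k) : Fin (n + 1) → ℝ) (Fin.last n) < (Fin.snoc θ (-∑ k, θ k) : Fin (n + 1) → ℝ) 0 + 2 * π →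
      ENNReal.ofReal ((∏ i, ∏ k ∈ Finset.univ.erase i,
        ‖(Circle.exp ((Fin.snoc θ (-∑ k, θ k) : Fin (n + 1) → ℝ) i) : ℂ) -
          (Circle.exp ((Fin.snoc θ (-∑ k, θ k) : Fin (n + 1) → ℝ) k) : ℂ)‖) / (Fintype.card (Fin (n + 1))).factorial) ≠ 0 := by
    intro θ h0 h1
    rw [ENNReal.ofReal_ne_zero_iff]
    refine div_pos (Finset.prod_pos fun i _ => Finset.prod_pos fun k hk => ?_) (by positivity)
    have hne := angleChart_sun_regular hE h0 h1 i k (Finset.ne_of_mem_erase hk).symm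
    rw [hE, hE] at hne
    exact norm_pos_iff.mpr (sub_ne_zero.mpr hne)
  set Jf : specialDiagonalTorus (Fin (n + 1)) → ℝ≥0∞ := fun t =>
    JD (fun i => ((t : Matrix.specialUnitaryGroup (Fin (n + 1)) ℂ) : Matrix (Fin (n + 1)) (Fin (n + 1)) ℂ) i i) *
      ENNReal.ofReal ((∏ i, ∏ k ∈ Finset.univ.erase i,
        ‖((t : Matrix.specialUnitaryGroup (Fin (n + 1)) ℂ) : Matrix (Fin (n + 1)) (Fin (n + 1)) ℂ) i i -
          ((t : Matrix.specialUnitaryGroup (Fin (n + 1)) ℂ) : Matrix (Fin (n + 1)) (Fin (n + 1)) ℂ) k k‖) /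
            (Fintype.card (Fin (n + 1))).factorial) /
      ENNReal.ofReal ((∏ i, ∏ k ∈ Finset.univ.erase i,
        ‖((fT t : Matrix.specialUnitaryGroup (Fin (n + 1)) ℂ) : Matrix (Fin (n + 1)) (Fin (n + 1)) ℂ) i i -
          ((fT t : Matrix.specialUnitaryGroup (Fin (n + 1)) ℂ) : Matrix (Fin (n + 1)) (Fin (n + 1)) ℂ) k k‖) /
            (Fintype.card (Fin (n + 1))).factorial)
    with hJf
  have hJfm : Measurable Jf := ((hJDm.comp hent).mul hDm).div (hDm.comp hfTm)
  have hJA : ∀ θ : Fin n → ℝ, StrictMono (Fin.snoc θ (-∑ k, θ k) : Fin (n + 1) → ℝ) →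
      (Fin.snoc θ (-∑ k, θ k) : Fin (n + 1) → ℝ) (Fin.last n) < (Fin.snoc θ (-∑ k, θ k) : Fin (n + 1) → ℝ) 0 + 2 * π →
        Jf (E θ) = JA θ := by
    intro θ h0 h1
    obtain ⟨g0, g1⟩ := hGA θ h0 h1
    simp only [hJf]
    rw [hcomm θ h0 h1]
    simp only [hE]
    rw [hJchart θ h0 h1]
    exact ENNReal.mul_div_cancel_right (hDne (G θ) g0 g1) ENNReal.ofReal_ne_top
  have hJinv : ∀ σ t, Jf (P σ t) = Jf t := by
    intro σ t
    simp only [hJf]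
    have hPent : (fun i => (((P σ t : specialDiagonalTorus (Fin (n + 1))) : Matrix.specialUnitaryGroup (Fin (n + 1)) ℂ) :
        Matrix (Fin (n + 1)) (Fin (n + 1)) ℂ) i i) =
        fun i => ((t : Matrix.specialUnitaryGroup (Fin (n + 1)) ℂ) : Matrix (Fin (n + 1)) (Fin (n + 1)) ℂ) (σ i) (σ i) :=
      funext (hP σ t)
    rw [hPent, hJDperm σ (fun k => ((t : Matrix.specialUnitaryGroup (Fin (n + 1)) ℂ) : Matrix (Fin (n + 1)) (Fin (n + 1)) ℂ) k k),
      hequiv]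
    simp only [hP]
    rw [vandermondeProd_perm σ (fun i => ((t : Matrix.specialUnitaryGroup (Fin (n + 1)) ℂ) : Matrix (Fin (n + 1)) (Fin (n + 1)) ℂ) i i),
      vandermondeProd_perm σ (fun i => ((fT t : Matrix.specialUnitaryGroup (Fin (n + 1)) ℂ) :
        Matrix (Fin (n + 1)) (Fin (n + 1)) ℂ) i i)]
  refine ⟨Jf, hJfm, hJA, hJinv, fun g t => ?_⟩
  by_cases hr : ∃ i j, i ≠ j ∧ ((t : Matrix.specialUnitaryGroup (Fin (n + 1)) ℂ) : Matrix (Fin (n + 1)) (Fin (n + 1)) ℂ) i i =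
      ((t : Matrix.specialUnitaryGroup (Fin (n + 1)) ℂ) : Matrix (Fin (n + 1)) (Fin (n + 1)) ℂ) j j
  · obtain ⟨i, j, hij, hd⟩ := hr
    have hfd : ((fT t : Matrix.specialUnitaryGroup (Fin (n + 1)) ℂ) : Matrix (Fin (n + 1)) (Fin (n + 1)) ℂ) i i =
        ((fT t : Matrix.specialUnitaryGroup (Fin (n + 1)) ℂ) : Matrix (Fin (n + 1)) (Fin (n + 1)) ℂ) j j := by
      rw [hfTent, hfTent]
      set d : Fin (n + 1) → ℂ := fun k => ((t : Matrix.specialUnitaryGroup (Fin (n + 1)) ℂ) :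
        Matrix (Fin (n + 1)) (Fin (n + 1)) ℂ) k k with hdd
      have hswap : (fun k => d (Equiv.swap i j k)) = d := by
        funext k
        by_cases hki : k = i
        · rw [hki, Equiv.swap_apply_left]; exact hd.symm
        · by_cases hkj : k = j
          · rw [hkj, Equiv.swap_apply_right]; exact hd
          · rw [Equiv.swap_apply_of_ne_of_ne hki hkj]
      have key := hfperm (Equiv.swap i j) d (norm_specialDiagonalTorus_apply t)
      rw [hswap] at key
      have hi := congr_fun key i
      simpa only [Equiv.swap_apply_left] using hi
    rw [vandermondeWeight_eq_zero_of_tie hij hd, vandermondeWeight_eq_zero_of_tie hij hfd, ENNReal.ofReal_zero,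
      mul_zero, mul_zero]
  · push Not at hr
    obtain ⟨σ, θ, ⟨h0, h1⟩, rfl⟩ := exists_permDiag_angleChart_of_regular_sun hE hP (fun i j hij => hr i j hij)
    have hgU : ((g : Matrix.specialUnitaryGroup (Fin (n + 1)) ℂ) : Matrix (Fin (n + 1)) (Fin (n + 1)) ℂ) ∈
        Matrix.unitaryGroup (Fin (n + 1)) ℂ := (Matrix.mem_specialUnitaryGroup_iff.mp g.2).1
    have hmul : ∀ A B : Matrix.specialUnitaryGroup (Fin (n + 1)) ℂ,
        ((A * B : Matrix.specialUnitaryGroup (Fin (n + 1)) ℂ) : Matrix (Fin (n + 1)) (Fin (n + 1)) ℂ) =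
          (A : Matrix (Fin (n + 1)) (Fin (n + 1)) ℂ) * (B : Matrix (Fin (n + 1)) (Fin (n + 1)) ℂ) := fun _ _ => rfl
    have hinv : ∀ A : Matrix.specialUnitaryGroup (Fin (n + 1)) ℂ,
        ((A⁻¹ : Matrix.specialUnitaryGroup (Fin (n + 1)) ℂ) : Matrix (Fin (n + 1)) (Fin (n + 1)) ℂ) =
          star (A : Matrix (Fin (n + 1)) (Fin (n + 1)) ℂ) := fun _ => rfl
    have hW : ((g * ((P σ (E θ) : specialDiagonalTorus (Fin (n + 1))) : Matrix.specialUnitaryGroup (Fin (n + 1)) ℂ) * g⁻¹ :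
        Matrix.specialUnitaryGroup (Fin (n + 1)) ℂ) : Matrix (Fin (n + 1)) (Fin (n + 1)) ℂ) =
        (g : Matrix (Fin (n + 1)) (Fin (n + 1)) ℂ) * diagonal (fun i => (((P σ (E θ) : specialDiagonalTorus (Fin (n + 1))) :
          Matrix.specialUnitaryGroup (Fin (n + 1)) ℂ) : Matrix (Fin (n + 1)) (Fin (n + 1)) ℂ) i i) *
            star (g : Matrix (Fin (n + 1)) (Fin (n + 1)) ℂ) := by
      rw [hmul, hmul, hinv, ← coe_specialDiagonalTorus_eq_diagonal]
    have hPent : (fun i => (((P σ (E θ) : specialDiagonalTorus (Fin (n + 1))) : Matrix.specialUnitaryGroup (Fin (n + 1)) ℂ) :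
        Matrix (Fin (n + 1)) (Fin (n + 1)) ℂ) i i) =
        fun i => (Circle.exp ((Fin.snoc θ (-∑ k, θ k) : Fin (n + 1) → ℝ) (σ i)) : ℂ) :=
      funext fun i => by rw [hP, hE]
    rw [hJspec _ _ _ hgU hW, hPent,
      hJDperm σ (fun i => (Circle.exp ((Fin.snoc θ (-∑ k, θ k) : Fin (n + 1) → ℝ) i) : ℂ)),
      hJinv, hequiv, hJA θ h0 h1, hcomm θ h0 h1]
    simp only [hP, hE]
    rw [vandermondeProd_perm σ (fun i => (Circle.exp ((Fin.snoc θ (-∑ k, θ k) : Fin (n + 1) → ℝ) i) : ℂ)),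
      vandermondeProd_perm σ (fun i => (Circle.exp ((Fin.snoc (G θ) (-∑ k, (G θ) k) : Fin (n + 1) → ℝ) i) : ℂ))]
    exact hJchart θ h0 h1

end Booked

end Summit.Ventures.LatticeQCDFlow.Exactness
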